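import Mathlib
import Summits.Ventures.HodgeRepro.Tier4.Target
import Summits.Ventures.HodgeRepro.Tier4.LitCompactness
import Summits.Ventures.HodgeRepro.Tier4.Line3.Defs
import Summits.Ventures.HodgeRepro.Tier4.Line3.DefsLemmas
import Summits.Ventures.HodgeRepro.Tier4.Line3.MainClassReps
import Summits.Ventures.HodgeRepro.Tier4.Line3.ClassFibres
import Summits.Ventures.HodgeRepro.Tier4.Line3.TorusInvariance
import Summits.Ventures.HodgeRepro.Tier4.Line3.CoefInvariance
import Summits.Ventures.HodgeRepro.Tier4.Line3.IntegrableMajorant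
import Summits.Ventures.HodgeRepro.Tier4.Line3.KernelIntegrable
import Summits.Ventures.HodgeRepro.Tier4.Line3.ClassSumSummable
import Summits.Ventures.HodgeRepro.Tier4.Line3.BaseClassWeight
import Summits.Ventures.HodgeRepro.Tier4.Line3.OffMainMassAssembly

/-!
# Tier4/Line3/MainTermLowerRe — L3.6 on BARE localiser data and on the REAL PART: the main term of a positive
localiser is eventually `≥ m > 0` in real part (t4-x2 g2; for the v0.39 assembly of t4-plan-3 g3, S13492 (4))

Blind re-derivation cell `pub-hodge-repro`, Tier 4 «PROVE THE STEP» (README §9–§10), LINE L3, seat t4-x2 (reserve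
wall-breaker, g2).  The skeleton's L3.6 `term_main_lower` (v0.29–v0.38) takes `ℓ : LocPS` and concludes on the NORM
`m ≤ ‖term …‖`; the v0.39 assembly (`LocalizerSumOff`, p679551, with `main_sum_lower_of_remainder`, p680415) needs the
REAL-PART form on the bare data `level / loc / main_one / pos` (no localiser structure: the interface is being re-typed).
This module is that theorem, with the same proof — `term = I_∞ · S_N` (L3.6a `term_main_unfold_of_wedge`, t4-L3-p1),
`S_N` a convergent series (L3.6b `classSum_summable`, t4-x2) of NON-NEGATIVE REALS (`pos`) whose base-class term is
`w_{c₀} · 1 ≥ m₀` (`main_one`, L3.6d `coefQ_mainRep_baseClass` below, L3.6c `baseClass_weight`, t4-L3-p2) — ending with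
`Re (I_∞ · S_N) = Re I_∞ · S_N ≥ Re I_∞ · m₀` (`S_N` is REAL: `Complex.im_tsum`).

Nothing here asserts anything about the truth of (P): `pos` on the main classes is the displayed positivity input of the
line (true of the natural localiser with the face identity `ε ≡ 1`, PosOfFactorisation / PosOfFactorisationAt).
HC_CM is NOT proved by anyone in this repository.
-/

set_option autoImplicit false

noncomputable section

namespace Summit.Ventures.HodgeRepro.Tier4.Line3

open Summit.Ventures.HodgeRepro.Tier4
open Matrix MeasureTheory NumberField
open Filter Topology
open scoped ComplexConjugate ComplexOrder

open scoped Classical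

namespace T4Data

variable (X : T4Data)

/-- **L3.6d THE COEFFICIENT AT THE BASE CLASS IS THE COEFFICIENT AT `xm`** (the skeleton's `coefQ_baseClass`, tree copy
under its own name): `mainRep K xm (baseClass K xm) = t • (γ₁ • xm)` with `γ₁ ∈ Γ′` and `t` in the torus, and `coefQ` is
invariant under both (`coefQ_smul` with `ThetaData.weight`, `coefQ_mulVec_mem_of_thetaData` with `ThetaData.invΓ`). -/
theorem coefQ_mainRep_baseClass (D : X.ThetaData) (xm : X.Tuple) (K : X.Level) (γ : X.Tr K) :
    X.coefQ D.cf γ (X.mainRep K xm (X.baseClass K xm)) = X.coefQ D.cf γ xm := by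
  have h1 : X.classOf K (X.lines (X.mainRep K xm (X.baseClass K xm))) = X.classOf K (X.lines xm) :=
    X.classOf_lines_mainRep K xm (X.baseClass K xm)
  obtain ⟨γ₁, hγ₁, hw⟩ := X.exists_mem_of_classOf_eq K (X.mainRep K xm (X.baseClass K xm)) h1
  obtain ⟨t, ht, hx⟩ := X.exists_torus_of_lines_eq hw.symm
  have hxm : xm = fun j => t j • (γ₁ *ᵥ X.mainRep K xm (X.baseClass K xm) j) := funext hx
  conv_rhs => rw [hxm]
  rw [X.coefQ_smul D.cf D.weight γ t ht, X.coefQ_mulVec_mem_of_thetaData D γ hγ₁]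

/-- **L3.6 ON BARE DATA, REAL-PART FORM.** For a symmetric tuple with independent first ball coordinates, a family of
levels and translates with `main_one` (`coefQ (loc N) xm = 1`) and `pos` (from some depth on the localised coefficient is
a non-negative real at every main class), under the printed BHC input `hlit` and the archimedean positivity `h7`:
the real part of the main orbital term is eventually `≥ m > 0`. -/
theorem term_main_lower_re (D : X.ThetaData)
    (hlit : Lit.BorelHarishChandra1962_Thm11_8_fundamentalDomain_hdef X.E X.H X.τ₀ X.C)
    {xm : X.Tuple} (h02 : xm 2 = xm 0) (h13 : xm 3 = xm 1)
    (hab : X.ballCoord (xm 0) 0 * X.ballCoord (xm 1) 1 - X.ballCoord (xm 0) 1 * X.ballCoord (xm 1) 0 ≠ 0)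
    {level : ℕ → X.Level} (loc : ∀ N : ℕ, X.Tr (level N))
    (hmain_one : ∀ N, X.coefQ D.cf (loc N) xm = 1)
    (hpos : ∃ N₀ : ℕ, ∀ N, N₀ ≤ N → ∀ c : X.MainClass (level N) xm,
      (X.coefQ D.cf (loc N) (X.mainRep (level N) xm c)).im = 0 ∧
        0 ≤ (X.coefQ D.cf (loc N) (X.mainRep (level N) xm c)).re)
    (h7 : IntegrableOn (fun z => X.kernel D.Φ xm z) ball ∧ 0 < (∫ z in ball, X.kernel D.Φ xm z).re) :
    ∃ m : ℝ, 0 < m ∧ ∀ᶠ N in atTop,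
      m ≤ (X.term D.Φ D.cf (level N) (loc N) (X.orbitOf (X.lines xm))).re := by
  obtain ⟨N₀, hpos⟩ := hpos
  obtain ⟨m₀, hm₀, hw⟩ := X.baseClass_weight xm hab
  set I : ℂ := ∫ z in ball, X.kernel D.Φ xm z with hIdef
  have hI : 0 < I.re := h7.2
  refine ⟨I.re * m₀, by positivity, ?_⟩
  filter_upwards [eventually_ge_atTop N₀] with N hN
  have hD := X.domain_isFundamental_of_lit' (level N) hlit
  have h2 := X.integrable_majorant D (level N) (loc N)
  rw [X.term_main_unfold_of_wedge D xm hab (level N) (loc N) hD h2]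
  -- the class sum is a convergent series of non-negative reals with the base-class term `≥ m₀`
  set f : X.MainClass (level N) xm → ℂ := fun c =>
    ((X.centerCard (level N) : ℂ) / (X.stabCard (level N) (X.mainRep (level N) xm c) : ℂ)) *
      X.coefQ D.cf (loc N) (X.mainRep (level N) xm c) with hf
  have hsum : Summable f := X.classSum_summable D xm h02 h13 hab (level N) (loc N) hD h2 h7
  have hwre : ∀ c, 0 ≤
      ((X.centerCard (level N) : ℂ) / (X.stabCard (level N) (X.mainRep (level N) xm c) : ℂ)).re := by
    intro c
    rw [← Complex.ofReal_natCast, ← Complex.ofReal_natCast, ← Complex.ofReal_div, Complex.ofReal_re]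
    positivity
  have hwim : ∀ c,
      ((X.centerCard (level N) : ℂ) / (X.stabCard (level N) (X.mainRep (level N) xm c) : ℂ)).im = 0 := by
    intro c
    rw [← Complex.ofReal_natCast, ← Complex.ofReal_natCast, ← Complex.ofReal_div, Complex.ofReal_im]
  have hre : ∀ c, 0 ≤ (f c).re := by
    intro c
    obtain ⟨him, hqre⟩ := hpos N hN c
    simp only [hf, Complex.mul_re, him, hwim c, mul_zero, sub_zero]
    exact mul_nonneg (hwre c) hqre
  have him : ∀ c, (f c).im = 0 := by
    intro c
    obtain ⟨him, -⟩ := hpos N hN c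
    simp only [hf, Complex.mul_im, him, hwim c, mul_zero, zero_mul, add_zero]
  have hbase : m₀ ≤ (f (X.baseClass (level N) xm)).re := by
    have h1 : X.coefQ D.cf (loc N) (X.mainRep (level N) xm (X.baseClass (level N) xm)) = 1 := by
      rw [X.coefQ_mainRep_baseClass D xm (level N) (loc N)]
      exact hmain_one N
    simp only [hf, h1, mul_one]
    exact hw (level N)
  have hS : X.classSum D.cf (loc N) xm = ∑' c, f c := rfl
  have hreS : m₀ ≤ (X.classSum D.cf (loc N) xm).re := by
    rw [hS, Complex.re_tsum hsum]
    exact hbase.trans ((Complex.hasSum_re hsum.hasSum).summable.le_tsum _ (fun j _ => hre j))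
  have himS : (X.classSum D.cf (loc N) xm).im = 0 := by
    rw [hS, Complex.im_tsum hsum]
    simp only [him, tsum_zero]
  rw [Complex.mul_re, himS, mul_zero, sub_zero]
  exact mul_le_mul_of_nonneg_left hreS hI.le

end T4Data

end Summit.Ventures.HodgeRepro.Tier4.Line3

end
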